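import Summits.BirchSwinnertonDyer.BirchSwinnertonDyer.Theorems.OneSidedTwistSqueezeX9KatoDivisibilityX9StubKolyvaginPrimePkX9
import Summits.BirchSwinnertonDyer.BirchSwinnertonDyer.Theorems.OneSidedTwistSqueezeX9KatoDivisibilityX9SahPk
import Summits.BirchSwinnertonDyer.BirchSwinnertonDyer.Theorems.OneSidedTwistSqueezeX9KatoDivisibilityX9GradedCoreAlgebra
import HarnessLib

set_option autoImplicit false

-- the summit and its single problem are both named `BirchSwinnertonDyer` (registry layout D-0017)
set_option linter.dupNamespace false

/-!
# Sah relative to `ker ρ_{E,p^k} ⊓ ker κ` for `E[p]`- and `𝒯_J(E)`-valued cocycles, and the DEFECT LEVEL bound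
# (service file of stub 1b' `stub_kolyvaginPrimePkDefectX9`, line `graded_euler_loss`, crux `KatoDivisibilityX9` =
# stmt-BirchSwinnertonDyer-20547)

Seat `bsd-line-k6-p4` (prover-bsd-line-k6-p4-g5-0, 5th LEAD).  THEOREMS ONLY, sorry-free, no definition, no named fact;
`--supports stmt-BirchSwinnertonDyer-20547 --as helper` (§1–§2 of the stub file `…StubKolyvaginPrimePkDefectX9.lean`,
split off for the 400-line limit; the stub = hypothesis `h12` of the landed bounded-defect assembly p627676).
The v3 form (`δ = 0`, full `T`-order of the test class) is the landed `…StubKolyvaginPrimePkX9.stub_kolyvaginPrimePkX9`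
(p626585); v4 needs the test class only up to a DEFECT `δ` (`T^{e−1−δ}ψ ≠ 0`), because the bounded-defect test pairs of
the repaired Selmer side give truncations of defect `δ₀`.

THE ARGUMENT, sharper than v3's (no index counting): let `H' = N_e(κ) ⊓ N_e(κ⁻¹) ⊓ ker ρ_{E,p^{d+1}}` and
`N = ker ρ_{E,p^{d+1}} ⊓ ker κ ≤ H'`.
* §1 SAH RELATIVE TO `N` for `E[p]`- and `𝒯_J(E)`-valued cocycles: the level-`p^k` central scalar `σ₁ ∈ ker κ`
  (`…CentralScalarPk`, `σ₁ = c` on `E[p^k]`, `p ∤ c − 1`) is central modulo `N` (`…SahPk.exists_mem_inf_mul_eq_of_zsmul_eq_pk`),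
  acts as `c` on `E[p]` and on every `𝒯_J(E, κ^{±1})`, and `c − 1` is invertible there; relative Sah (`SahRel`) ⟹ a cocycle
  vanishing on `N` is a coboundary.
* Hence `φ(H') = 𝒯_e` (ALL of it: `LevelE.valueSubgroup_eq_top_of_towerConst_ne_zero` with the Sah input on `H' ⊇ N`), and
  `ψ(H') = T^{c}𝒯_e` (`LevelE.modPTwist_stable_addSubgroup_eq_tPow`) with `c ≤ δ` (§2: if `c ≥ δ + 1` the truncation of `ψ` to
  level `δ + 1` vanishes on `N`, so its class is `0`, so `T^{e−1−δ}[ψ] = T·-embedding of it = 0`).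
* Polarisation with `x`-slots `(0,1)` and `y`-slots `(c, c+1)` (p614716) and read-off (`…DefectLevels`): `C_c` or `C_{c+1} ≠ 0`,
  `j ≤ δ + 1 = c₀ + 1` with `c₀ := δ`; Chebotarev half p624294; `N₁ := max n₁ (δ + 2)`.

HONEST LABEL: closes the registered stub 1b' of the DEPTH obligation; stubs 1s / 1a' / 1c' / width / F1_ζ and the crux stay
OPEN; PARTITION untouched; beyond-print theorem toward BSD: NO; no summit statement is proved by this seat; BSD is not proved
by any of this.

References: C.-H. Sah, J. Algebra 10 (1968) Prop. 2.7 (b) [Sah1968]; J.-P. Serre, Invent. Math. 15 (1972) §2.4 Prop. 15, §2.6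
[Serre1972]; B. Mazur, K. Rubin, Mem. AMS 799 (2004) §4.4, §5.3 [MazurRubin2004]; J. Tate in Cassels–Fröhlich VII §2.4
[TateGCFT1967]; HOME/MEMO-es.md §15, §25.7.
-/

noncomputable section

open scoped Classical NumberField ContRepresentation
open WeierstrassCurve Field IsDedekindDomain Function
open Literature.NumberTheory.GaloisRepresentations
open Literature.NumberTheory.GaloisCohomology
open Literature.NumberTheory.EllipticCurves
open Summit.BirchSwinnertonDyer.BirchSwinnertonDyer.Rank1Residual
open Summit.BirchSwinnertonDyer.BirchSwinnertonDyer.Theorems.OneSidedTwistSqueezeX9KatoDivisibilityX9ChebotarevPk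
open Summit.BirchSwinnertonDyer.BirchSwinnertonDyer.Theorems.OneSidedTwistSqueezeX9KatoDivisibilityX9DefectLevels
open Summit.BirchSwinnertonDyer.BirchSwinnertonDyer.Theorems.OneSidedTwistSqueezeX9KatoDivisibilityX9CentralScalarPk
open Summit.BirchSwinnertonDyer.BirchSwinnertonDyer.Theorems.OneSidedTwistSqueezeX9KatoDivisibilityX9SahPk
open Summit.BirchSwinnertonDyer.BirchSwinnertonDyer.Theorems.OneSidedTwistSqueezeX9KatoDivisibilityX9GradedCoreAlgebra

namespace Summit.BirchSwinnertonDyer.BirchSwinnertonDyer.Theorems.OneSidedTwistSqueezeX9KatoDivisibilityX9SahRelPk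

/-! ## §1 Sah relative to `N = ker ρ_{E,p^k} ⊓ ker κ` for `E[p]`- and `𝒯_J(E)`-valued cocycles -/

section SahRelPk

/-- `x ↦ c•x − x` is bijective on an abelian group killed by `p` when `p ∤ c − 1` (Bézout: `u(c−1) + v p = 1`).
[cite: Serre1972, §2.6] -/
theorem bijective_zsmul_sub_self_of_torsion {A : Type*} [AddCommGroup A] {p : ℕ} (hp : p.Prime)
    (hA : ∀ a : A, (p : ℤ) • a = 0) {c : ℤ} (hc : ¬ ((p : ℤ) ∣ (c - 1))) :
    Bijective fun a : A => c • a - a := by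
  have hp' : Prime (p : ℤ) := Nat.prime_iff_prime_int.mp hp
  obtain ⟨u, v, huv⟩ := ((Prime.coprime_iff_not_dvd hp').mpr hc).symm
  have hfun : ∀ a : A, c • a - a = (c - 1) • a := fun a => by rw [sub_smul, one_smul]
  have hinv : ∀ a : A, u • ((c - 1) • a) = a := fun a => by
    have h1 : a = (u * (c - 1) + v * (p : ℤ)) • a := by rw [huv, one_smul]
    conv_rhs => rw [h1]
    rw [add_smul, mul_smul, mul_smul, hA, smul_zero, add_zero]
  refine ⟨fun a b hab => ?_, fun b => ⟨u • b, ?_⟩⟩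
  · have h := congrArg (fun z => u • z) hab
    simp only [hfun, hinv] at h
    exact h
  · change c • (u • b) - u • b = b
    rw [hfun, smul_comm, hinv]

variable (W : WeierstrassCurve ℚ) [W.IsElliptic] (p : ℕ) [Fact p.Prime] (κ : ZpExtension ℚ p)

omit [W.IsElliptic] [Fact p.Prime] in
/-- An element acting on `E[p^k]` (`k ≥ 1`) as the integer scalar `c` acts on `E[p] ⊆ E[p^k]` as `c`. [folklore] -/
theorem smul_eq_zsmul_of_pow {k : ℕ} (hk : 1 ≤ k) {σ₁ : absoluteGaloisGroup ℚ} {c : ℤ}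
    (hσ₁ : ∀ P : geomTorsion W ((p : ℤ) ^ k), σ₁ • P = c • P) (Q : geomTorsion W (p : ℤ)) :
    σ₁ • Q = c • Q := by
  have hQ : (Q : geomPoints W) ∈ geomTorsion W ((p : ℤ) ^ k) := by
    have h := Q.2
    simp only [Submodule.mem_toAddSubgroup, Submodule.mem_torsionBy_iff] at h ⊢
    obtain ⟨j, hj⟩ : ∃ j, k = j + 1 := ⟨k - 1, by omega⟩
    rw [hj, pow_succ, mul_smul, h, smul_zero]
  have h1 := congrArg (fun z : geomTorsion W ((p : ℤ) ^ k) => (z : geomPoints W)) (hσ₁ ⟨(Q : geomPoints W), hQ⟩)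
  apply Subtype.ext
  simpa [Literature.NumberTheory.EllipticCurves.AddSubgroup.torsionBy.coe_smul] using h1

/-- **Sah relative to `ker ρ_{E,p^k} ⊓ ker κ` for `E[p]`-valued cocycles** (`p` odd, `E[p]` irreducible, `ρ̄` not onto,
`k ≥ 1`): a continuous 1-cocycle of `Γ_ℚ` in `E[p]` vanishing on `ker ρ_{E,p^k} ⊓ ker κ` is a coboundary.
[cite: Sah1968, Prop. 2.7 (b) and its proof, p. 60] [cite: Serre1972, §2.4 Prop. 15 and §2.6] -/
theorem torsion_oneCocycleClass_eq_zero_of_forall_mem_pk_eq_zero (hp2 : p ≠ 2)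
    (hirr : W.HasIrreducibleModPGaloisRep p) (hns : ¬ W.HasSurjectiveModNGaloisRep p) {k : ℕ} (hk : 1 ≤ k)
    (φ : contOneCocycles (W.torsionGaloisModule (p : ℤ)).toTopRep)
    (hN : ∀ ν ∈ (galoisRepTorsion W ((p : ℤ) ^ k)).ker ⊓ κ.kerSubgroup, φ.1 ν = 0) :
    oneCocycleClass _ φ = 0 := by
  have hp : p.Prime := Fact.out
  obtain ⟨σ₁, c, hc, hκ, hσ₁⟩ := exists_mem_kerSubgroup_smul_eq_pk_of_ne_two W p κ hp2 hirr hns k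
  have hσ₁' : ∀ Q : geomTorsion W (p : ℤ), σ₁ • Q = c • Q := smul_eq_zsmul_of_pow W p hk hσ₁
  have hρ : ∀ (g : absoluteGaloisGroup ℚ) (x : (W.torsionGaloisModule (p : ℤ)).toTopRep),
      (W.torsionGaloisModule (p : ℤ)).toTopRep.ρ g x = g • x := fun g x =>
    WeierstrassCurve.torsionGaloisModule_apply_apply W (p : ℤ) g x
  have hA : ∀ a : geomTorsion W (p : ℤ), (p : ℤ) • a = 0 := fun a => by
    apply Subtype.ext
    have ha := a.2
    simp only [Submodule.mem_toAddSubgroup, Submodule.mem_torsionBy_iff] at ha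
    rw [AddSubgroupClass.coe_zsmul, ZeroMemClass.coe_zero]
    exact ha
  refine SahRel.oneCocycleClass_eq_zero_of_forall_mem_eq_zero φ _ hN
    (exists_mem_inf_mul_eq_of_zsmul_eq_pk W p k κ hσ₁ hκ) (fun g x => ?_) ?_
  · rw [hρ, hρ, hρ, hρ, hσ₁', hσ₁', smul_comm]
  · have : (fun x : (W.torsionGaloisModule (p : ℤ)).toTopRep =>
        (W.torsionGaloisModule (p : ℤ)).toTopRep.ρ σ₁ x - x) = fun x : geomTorsion W (p : ℤ) => c • x - x := by
      funext x
      rw [hρ, hσ₁']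
    rw [this]
    exact bijective_zsmul_sub_self_of_torsion hp hA hc

/-- **Sah relative to `ker ρ_{E,p^k} ⊓ ker κ` for `𝒯_J(E, κ')`-valued cocycles** (`κ'` any `ℤ_p`-extension with the same
kernel as `κ`, e.g. `κ` or `κ⁻¹`; `p` odd, `E[p]` irreducible, `ρ̄` not onto, `k ≥ 1`): a continuous 1-cocycle of `Γ_ℚ` in
`W.modPTwist p κ' J` vanishing on `ker ρ_{E,p^k} ⊓ ker κ` is a coboundary.
[cite: Sah1968, Prop. 2.7 (b) and its proof, p. 60] [cite: Serre1972, §2.4 Prop. 15 and §2.6] -/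
theorem modPTwist_oneCocycleClass_eq_zero_of_forall_mem_pk_eq_zero (hp2 : p ≠ 2)
    (hirr : W.HasIrreducibleModPGaloisRep p) (hns : ¬ W.HasSurjectiveModNGaloisRep p) {k : ℕ} (hk : 1 ≤ k)
    (κ' : ZpExtension ℚ p) (hker : κ'.kerSubgroup = κ.kerSubgroup) (J : ℕ)
    (φ : contOneCocycles (W.modPTwist p κ' J).toTopRep)
    (hN : ∀ ν ∈ (galoisRepTorsion W ((p : ℤ) ^ k)).ker ⊓ κ.kerSubgroup, φ.1 ν = 0) :
    oneCocycleClass _ φ = 0 := by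
  have hp : p.Prime := Fact.out
  obtain ⟨σ₁, c, hc, hκ, hσ₁⟩ := exists_mem_kerSubgroup_smul_eq_pk_of_ne_two W p κ hp2 hirr hns k
  have hσ₁' : ∀ Q : geomTorsion W (p : ℤ), σ₁ • Q = c • Q := smul_eq_zsmul_of_pow W p hk hσ₁
  have hκ' : σ₁ ∈ κ'.kerSubgroup := by rw [hker]; exact hκ
  have hρ : ∀ x : (W.modPTwist p κ' J).toTopRep, (W.modPTwist p κ' J).toTopRep.ρ σ₁ x = c • x := fun x => by
    change W.modPTwist p κ' J σ₁ x = c • x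
    rw [modPTwist_apply_of_mem_kerSubgroup W p κ' J hκ']
    funext i
    rw [hσ₁', Pi.smul_apply]
  have hA : ∀ a : Fin J → geomTorsion W (p : ℤ), (p : ℤ) • a = 0 := fun a => by
    funext i
    apply Subtype.ext
    have ha := (a i).2
    simp only [Submodule.mem_toAddSubgroup, Submodule.mem_torsionBy_iff] at ha
    rw [Pi.smul_apply, Pi.zero_apply, AddSubgroupClass.coe_zsmul, ZeroMemClass.coe_zero]
    exact ha
  refine SahRel.oneCocycleClass_eq_zero_of_forall_mem_eq_zero φ _ hN
    (exists_mem_inf_mul_eq_of_zsmul_eq_pk W p k κ hσ₁ hκ) (fun g x => ?_) ?_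
  · rw [hρ, hρ, map_zsmul]
  · have : (fun x : (W.modPTwist p κ' J).toTopRep => (W.modPTwist p κ' J).toTopRep.ρ σ₁ x - x) =
        fun x : Fin J → geomTorsion W (p : ℤ) => c • x - x := by
      funext x
      rw [hρ]
    rw [this]
    exact bijective_zsmul_sub_self_of_torsion hp hA hc

omit [W.IsElliptic] in
/-- `ker ρ_{E,p^k} ⊓ ker κ` (`k ≥ 1`) acts trivially on `𝒯_J(E, κ)`: it lies in `N_J(κ)`. [cite: Washington1997, §13.1–§13.2] -/
theorem ker_inf_kerSubgroup_le_ker_twistModPRepresentation {k : ℕ} (hk : 1 ≤ k) (J : ℕ) :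
    (galoisRepTorsion W ((p : ℤ) ^ k)).ker ⊓ κ.kerSubgroup ≤
      (κ.twistModPRepresentation (W.torsionGaloisModule (p : ℤ))
        (fun P : geomTorsion W (p : ℤ) => AddSubgroup.torsionBy.nsmul P) J).ker := by
  have hp : p.Prime := Fact.out
  have hJ : J ≤ p ^ J := (Nat.lt_pow_self hp.one_lt).le
  refine le_trans (inf_le_inf (ker_galoisRepTorsion_pow_le W p hk) (κ.kerSubgroup_le_layerSubgroup J)) ?_
  exact ker_inf_layerSubgroup_le_ker_twistModPRepresentation W p κ hJ

end SahRelPk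

/-! ## §2 The defect level of `ψ(S)` is at most the defect `δ` of the class of `ψ` -/

section DefectLevel

variable (W : WeierstrassCurve ℚ) [W.IsElliptic] (p : ℕ) [Fact p.Prime] (κ : ZpExtension ℚ p)

/-- **Defect level ≤ defect of the class.**  `p` odd, `E[p]` irreducible, `ρ̄` not onto, `k ≥ 1`; `ψ` a cocycle of the dual
twist `𝒯_e(E, κ⁻¹)` (`e = e' + 1`) with `T^{e'−δ}[ψ] ≠ 0`; `S` a subgroup acting trivially on `𝒯_e(κ⁻¹)` and containing
`N = ker ρ_{E,p^k} ⊓ ker κ`; if `ψ(S) = T^c𝒯_e` (all values vanish exactly below slot `c`), then `c ≤ δ`: otherwise the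
truncation of `ψ` to level `δ + 1` vanishes on `N`, hence is a coboundary (§1), hence `T^{e'−δ}[ψ]` — its `T^{e'−δ}`-embedding
back to level `e` — vanishes. [cite: Sah1968, Prop. 2.7 (b)] [cite: Washington1997, §13.1–§13.2] -/
theorem defectLevel_le_of_shiftH1_iterate_ne_zero (hp2 : p ≠ 2)
    (hirr : W.HasIrreducibleModPGaloisRep p) (hns : ¬ W.HasSurjectiveModNGaloisRep p) {k : ℕ} (hk : 1 ≤ k)
    {e' δ : ℕ} (ψ : contOneCocycles (W.modPTwist p κ.invTwist (e' + 1)).toTopRep)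
    (hψT : (κ.invTwist.shiftH1 (W.torsionGaloisModule (p : ℤ))
      (fun P : geomTorsion W (p : ℤ) => AddSubgroup.torsionBy.nsmul P) (e' + 1))^[e' - δ]
        (oneCocycleClass (W.modPTwist p κ.invTwist (e' + 1)).toTopRep ψ) ≠ 0)
    (S : Subgroup (absoluteGaloisGroup ℚ))
    (hY : ∀ τ ∈ S, ∀ y : (W.modPTwist p κ.invTwist (e' + 1)).toTopRep,
      (W.modPTwist p κ.invTwist (e' + 1)).toTopRep.ρ τ y = y)
    (hNS : (galoisRepTorsion W ((p : ℤ) ^ k)).ker ⊓ κ.kerSubgroup ≤ S) {c : ℕ}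
    (hval : ∀ x, x ∈ contOneCocycles.valueSubgroup ψ S hY ↔ ∀ i : Fin (e' + 1), (i : ℕ) < c → x i = 0) :
    c ≤ δ := by
  by_contra hcδ
  have hcδ' : δ + 1 ≤ c := by omega
  -- every value of `ψ` on `S` vanishes below `c`, and `c ≤ e' + 1` unless `ψ(S) = 0`; in any case below `δ + 1`
  by_cases hδe : e' + 1 < δ + 1
  · -- then `e' - δ = 0` and `T^0 [ψ] = [ψ]`; `ψ` itself vanishes on `N`
    have h0 : e' - δ = 0 := by omega
    rw [h0, Function.iterate_zero, id_eq] at hψT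
    apply hψT
    refine modPTwist_oneCocycleClass_eq_zero_of_forall_mem_pk_eq_zero W p κ hp2 hirr hns hk κ.invTwist
      (ZpExtension.kerSubgroup_unitTwist κ (-1)) (e' + 1) ψ fun ν hν => ?_
    have hv := (hval (ψ.1 ν)).mp ⟨ν, hNS hν, rfl⟩
    funext i
    exact hv i (by omega)
  · have hle : δ + 1 ≤ e' + 1 := by omega
    -- the truncation of `ψ` to level `δ + 1` vanishes on `N`
    set ψr := κ.invTwist.pushCocycle (W.torsionGaloisModule (p : ℤ))
      (fun P : geomTorsion W (p : ℤ) => AddSubgroup.torsionBy.nsmul P) (e' + 1)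
      (κ.invTwist.twistModPTruncate (W.torsionGaloisModule (p : ℤ)) _ (e' + 1) hle) ψ with hψr
    have hψr0 : oneCocycleClass (κ.invTwist.twistModP (W.torsionGaloisModule (p : ℤ))
        (fun P : geomTorsion W (p : ℤ) => AddSubgroup.torsionBy.nsmul P) (δ + 1)).toTopRep ψr = 0 := by
      refine modPTwist_oneCocycleClass_eq_zero_of_forall_mem_pk_eq_zero W p κ hp2 hirr hns hk κ.invTwist
        (ZpExtension.kerSubgroup_unitTwist κ (-1)) (δ + 1) ψr fun ν hν => ?_
      have hv := (hval (ψ.1 ν)).mp ⟨ν, hNS hν, rfl⟩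
      funext i
      change ψ.1 ν (Fin.castLE hle i) = 0
      exact hv _ (by simp only [Fin.val_castLE]; omega)
    -- `T^{e'−δ}[ψ]` is the `T^{e'−δ}`-embedding of the class of `ψr`
    apply hψT
    refine (ZpExtension.shiftH1_iterate_oneCocycleClass κ.invTwist (W.torsionGaloisModule (p : ℤ)) _ (e' + 1)
      (e' - δ) ψ).trans ?_
    have h2 : κ.invTwist.shiftPowCocycle (W.torsionGaloisModule (p : ℤ)) _ (e' + 1) (e' - δ) ψ =
        κ.invTwist.pushCocycle (W.torsionGaloisModule (p : ℤ)) _ (δ + 1)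
          (κ.invTwist.twistModPShiftEmbed (W.torsionGaloisModule (p : ℤ)) _ (e' + 1) hle)
          (κ.invTwist.shiftPowCocycle (W.torsionGaloisModule (p : ℤ)) _ (δ + 1)
            ((e' - δ) - (e' + 1 - (δ + 1))) ψr) :=
      Subtype.ext (ContinuousMap.ext fun σ =>
        shiftEnd_pow_eq_shiftEmbed_shiftEnd_pow_castLE_of_le hle (by omega) (ψ.1 σ))
    rw [h2, ← ZpExtension.map_oneCocycleClass_twist, ← ZpExtension.shiftH1_iterate_oneCocycleClass]
    have hz : (⇑(κ.invTwist.shiftH1 (W.torsionGaloisModule (p : ℤ))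
        (fun P : geomTorsion W (p : ℤ) => AddSubgroup.torsionBy.nsmul P) (δ + 1)))^[e' - δ - (e' + 1 - (δ + 1))]
        (oneCocycleClass _ ψr) = 0 := by
      rw [hψr0]; exact iterate_map_zero _ _
    rw [hz, map_zero]

end DefectLevel


end Summit.BirchSwinnertonDyer.BirchSwinnertonDyer.Theorems.OneSidedTwistSqueezeX9KatoDivisibilityX9SahRelPk

end
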